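import Summits.HodgeConjecture.HodgeConjecture.Theorems.Ring2WeilCoverageCMFieldRationalPrimeRule
import HarnessLib

/-!
# Ring 2 — Weil-family coverage, CM-field rows: rational primes INERT in `F` and in `E/F` — `[ℓ] ≠ [1]` whenever
  `p² - 4q` AND `q` are non-squares mod `ℓ` (the cyclic carriers: «every prime inert in `F` is a non-norm»)
  (WEIL-FAMILY-COVERAGE «## b03», cell (xxi″), part 21)

research route conditional on HC_CM; not a corollary; Q11.4-sentence-2 already refuted in dim ≥ 3.

On Deligne's quadratic carrier `R = S² + pS + q` (`F = ℚ(θ)`, `E = F(√θ)`, rows `δ ∈ F^×/Nm_{E/F}(E^×)` labelled by the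
`T`-sets `{𝔭 : (q, θ)_𝔭 = -1}`) [cite: Deligne1982HodgeCycles, §4 p. 30, (1), Cor. 4.2] the biquadratic fields were settled
in parts 14–20.  For the CYCLIC quartic fields of the census (`ℚ(ζ₅)`, `ℚ(√-(2+√2))`; `ℚ(√-3(2+√2))`, `ℚ(√-(5+√5))`,
`ℚ(√-3(5+√5)/2)` of §b03.29) the closed form (S, §b03.29 (3)) says «every prime INERT in `F` is a NON-norm».  This file
proves the uniform kernel statement behind it, for every quadratic carrier:

* §52 the prime field of a finite field of characteristic `ℓ`: `x^ℓ = x ⟹ x ∈ 𝔽_ℓ` (root count of `X^ℓ - X`).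
* §53 **THEOREM.** `ℓ` an odd prime with `p² - 4q` a NON-square mod `ℓ` (so `ℓ` is inert in `F`: the place `v = (ℓ)`,
  `𝓞_F/v = 𝔽_{ℓ²}`, `ord_v ℓ = 1`) and `q = N_{F/ℚ}(θ)` a NON-square mod `ℓ`.  Then `θ` is a non-square mod `v`: the
  Frobenius `x ↦ x^ℓ` of `𝔽_{ℓ²}` sends `θ̄` to the other root `-p - θ̄` (it is not `θ̄`, which is outside `𝔽_ℓ`), so
  `θ̄^{ℓ+1} = q̄`, and `θ̄ = u²` would make `q̄ = (u^{ℓ+1})²` a square IN `𝔽_ℓ`.  Hence `v ∈ T(ℓ)` (O'Meara 63:12, part 3) and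
  **`[ℓ] ≠ [(-1)^k]` for every `k`** (`mk_natCast_ne_splitDiscriminantClassCM_of_not_isSquare_disc_const`).
* §54 instances: the five cyclic carriers (`q = d·m₀²`, `p² - 4q = d·m²` with `F = ℚ(√d)`): `[ℓ] ≠ [1]` for every prime
  `ℓ ≡ ±2 (mod 5)` (`ℚ(ζ₅)`, `ℚ(√-(5+√5))`, `ℚ(√-3(5+√5)/2)`; `ℓ ≠ 3` for the last) resp. `ℓ ≡ ±3 (mod 8)`
  (`ℚ(√-(2+√2))`, `ℚ(√-3(2+√2))`; `ℓ ≠ 3` for the last) — the inert halves of b03.16 re-derived and extended.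
No new definition, no named fact, no sorry; nothing about the Hodge conjecture is asserted.
-/

noncomputable section

set_option linter.dupNamespace false

open Polynomial NumberField IsDedekindDomain

namespace Summit.HodgeConjecture.HodgeConjecture.Ring2.WeilCoverageCM

open Literature.AlgebraicGeometry.Deligne1982
open Literature.AlgebraicGeometry.HodgeTheory (splitDiscriminantClassCM)
open Literature.NumberTheory.QuadraticForms

/-! ### §52 The prime field of a finite field: `x^ℓ = x ⟹ x ∈ 𝔽_ℓ` -/

/-- **In a finite domain of characteristic `ℓ`, the solutions of `x^ℓ = x` are the `ℓ` elements of the prime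
field** (`X^ℓ - X` has at most `ℓ` roots, and the image of `𝔽_ℓ` supplies `ℓ` of them). [folklore] -/
theorem exists_zmod_cast_eq_of_pow_eq_self {K : Type*} [CommRing K] [IsDomain K] [Fintype K] {ℓ : ℕ} [Fact ℓ.Prime]
    [CharP K ℓ] {x : K} (hx : x ^ ℓ = x) : ∃ i : ZMod ℓ, ZMod.castHom (dvd_refl ℓ) K i = x := by
  classical
  set ψ := ZMod.castHom (dvd_refl ℓ) K with hψ
  have hℓ1 : 1 < ℓ := (Fact.out : ℓ.Prime).one_lt
  set P : K[X] := X ^ ℓ - X with hP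
  have hPdeg : P.natDegree = ℓ := by
    rw [hP, natDegree_sub_eq_left_of_natDegree_lt] <;> simp [hℓ1]
  have hP0 : P ≠ 0 := fun h ↦ by rw [h, natDegree_zero] at hPdeg; omega
  have hmem : ∀ y : K, y ∈ P.roots.toFinset ↔ y ^ ℓ = y := fun y ↦ by
    rw [Multiset.mem_toFinset, mem_roots hP0, IsRoot, eval_sub, eval_pow, eval_X, sub_eq_zero]
  -- the image of `𝔽_ℓ` consists of roots, and has `ℓ` elements
  set S : Finset K := Finset.univ.image ψ with hS
  have hSsub : S ⊆ P.roots.toFinset := by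
    intro y hy
    obtain ⟨i, -, rfl⟩ := Finset.mem_image.1 hy
    rw [hmem, ← map_pow, ZMod.pow_card]
  have hScard : S.card = ℓ := by
    rw [hS, Finset.card_image_of_injective _ ψ.injective, Finset.card_univ, ZMod.card]
  have hle : P.roots.toFinset.card ≤ S.card := by
    rw [hScard]
    calc P.roots.toFinset.card ≤ Multiset.card P.roots := Multiset.toFinset_card_le _
      _ ≤ P.natDegree := card_roots' P
      _ = ℓ := hPdeg
  have hEq : S = P.roots.toFinset := Finset.eq_of_subset_of_card_le hSsub hle
  have hxS : x ∈ S := by rw [hEq, hmem]; exact hx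
  obtain ⟨i, -, hi⟩ := Finset.mem_image.1 hxS
  exact ⟨i, hi⟩

/-! ### §53 `θ` is a non-square at a prime inert in `F` with `q` a non-square mod `ℓ` -/

section Inert

variable {R : Polynomial ℤ} [Fact (Irreducible (cmPolyQ R))] [Fact (Irreducible (realPolyQ R))]

omit [Fact (Irreducible (cmPolyQ R))] in
/-- **A residue field of char `ℓ` in which `R` has a root but `p² - 4q` is a non-square mod `ℓ` is NOT `𝔽_ℓ`**: at a
place `v ∋ ℓ` of the quadratic field `F`, `N v = ℓ²` (`N v = ℓ` would put `θ̄ ∈ 𝔽_ℓ` and make `(2θ̄+p)² = p² - 4q` a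
square mod `ℓ`). [folklore] -/
theorem absNorm_eq_sq_of_not_isSquare_disc {p q : ℤ} (hR : R = X ^ 2 + C p * X + C q)
    {θₒ : 𝓞 (realField R)} (hθ : (θₒ : realField R) = AdjoinRoot.root (realPolyQ R)) {ℓ : ℕ} (hℓ : ℓ.Prime)
    (hdisc : ¬ IsSquare ((p ^ 2 - 4 * q : ℤ) : ZMod ℓ)) (v : HeightOneSpectrum (𝓞 (realField R)))
    (hℓv : (ℓ : 𝓞 (realField R)) ∈ v.asIdeal) : Ideal.absNorm v.asIdeal = ℓ ^ 2 := by
  rcases absNorm_eq_or_eq_sq_of_natCast_mem (finrank_realField_quadratic hR) v hℓ hℓv with h | h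
  · exfalso
    have hrel := ringOfIntegers_root_rel_quadratic hR hθ
    have hsqO : ((p ^ 2 - 4 * q : ℤ) : 𝓞 (realField R)) = (2 * θₒ + p) * (2 * θₒ + p) := by
      push_cast; linear_combination (-4 : 𝓞 (realField R)) * hrel
    refine hdisc ((isSquare_intCast_residue_iff_of_absNorm_eq v hℓ h _).1 ?_)
    exact ⟨Ideal.Quotient.mk v.asIdeal (2 * θₒ + p), by rw [← map_mul, ← hsqO]⟩
  · exact h

omit [Fact (Irreducible (cmPolyQ R))] in
/-- **`θ` is a NON-SQUARE modulo a prime `v ∋ ℓ` when `p² - 4q` and `q` are non-squares mod `ℓ`** (`ℓ` odd).  In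
`𝓞_F/v = 𝔽_{ℓ²}` the Frobenius `x ↦ x^ℓ` maps `θ̄` to a root of `R̄`, not to `θ̄` (else `θ̄ ∈ 𝔽_ℓ`, a root of `R` mod
`ℓ`), hence to `-p - θ̄`; so `θ̄^{ℓ+1} = θ̄(-p-θ̄) = q̄`, and `θ̄ = u²` would give `q̄ = w²` with `w = u^{ℓ+1}` fixed by
Frobenius, i.e. `q` a square mod `ℓ`. [folklore] -/
theorem not_isSquare_residue_root_of_not_isSquare_disc_const {p q : ℤ} (hR : R = X ^ 2 + C p * X + C q)
    {θₒ : 𝓞 (realField R)} (hθ : (θₒ : realField R) = AdjoinRoot.root (realPolyQ R)) {ℓ : ℕ} (hℓ : ℓ.Prime)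
    (hdisc : ¬ IsSquare ((p ^ 2 - 4 * q : ℤ) : ZMod ℓ)) (hq : ¬ IsSquare ((q : ℤ) : ZMod ℓ))
    (v : HeightOneSpectrum (𝓞 (realField R))) (hℓv : (ℓ : 𝓞 (realField R)) ∈ v.asIdeal) :
    ¬ IsSquare (Ideal.Quotient.mk v.asIdeal θₒ) := by
  classical
  haveI := Fact.mk hℓ
  haveI : v.asIdeal.IsPrime := v.isPrime
  haveI : Finite (𝓞 (realField R) ⧸ v.asIdeal) := v.asIdeal.finiteQuotientOfFreeOfNeBot v.ne_bot
  letI : Fintype (𝓞 (realField R) ⧸ v.asIdeal) := Fintype.ofFinite _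
  have hN := absNorm_eq_sq_of_not_isSquare_disc hR hθ hℓ hdisc v hℓv
  have hcard : Fintype.card (𝓞 (realField R) ⧸ v.asIdeal) = ℓ ^ 2 := by rw [card_quotient_eq_absNorm, hN]
  haveI hchar : CharP (𝓞 (realField R) ⧸ v.asIdeal) ℓ := charP_of_card_eq_prime_pow hcard
  haveI : ExpChar (𝓞 (realField R) ⧸ v.asIdeal) ℓ := ExpChar.prime hℓ
  set ψ := ZMod.castHom (dvd_refl ℓ) (𝓞 (realField R) ⧸ v.asIdeal) with hψ
  set t : 𝓞 (realField R) ⧸ v.asIdeal := Ideal.Quotient.mk v.asIdeal θₒ with ht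
  have hrel := ringOfIntegers_root_rel_quadratic hR hθ
  -- the root relation in the residue field
  have hrelk : t ^ 2 + (p : 𝓞 (realField R) ⧸ v.asIdeal) * t + (q : 𝓞 (realField R) ⧸ v.asIdeal) = 0 := by
    have h := congrArg (Ideal.Quotient.mk v.asIdeal) hrel
    rwa [map_add, map_add, map_mul, map_pow, map_intCast, map_intCast, map_zero] at h
  -- no root of `R` in `𝔽_ℓ`
  have hnoroot : ∀ i : ZMod ℓ, i ^ 2 + (p : ZMod ℓ) * i + (q : ZMod ℓ) ≠ 0 :=
    no_root_of_disc_not_isSquare p q (by push_cast at hdisc ⊢; exact hdisc)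
  -- Frobenius: `t^ℓ` is a root of `R̄`, and it is not `t`
  have hfrob_root : (t ^ ℓ) ^ 2 + (p : 𝓞 (realField R) ⧸ v.asIdeal) * t ^ ℓ + (q : 𝓞 (realField R) ⧸ v.asIdeal) = 0 := by
    have h := congrArg (frobenius (𝓞 (realField R) ⧸ v.asIdeal) ℓ) hrelk
    rw [map_add, map_add, map_mul, map_pow, map_intCast, map_intCast, map_zero, frobenius_def] at h
    exact h
  have hne : t ^ ℓ ≠ t := fun hfix ↦ by
    obtain ⟨i, hi⟩ := exists_zmod_cast_eq_of_pow_eq_self (K := 𝓞 (realField R) ⧸ v.asIdeal) hfix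
    apply hnoroot i
    apply ψ.injective
    rw [map_add, map_add, map_mul, map_pow, map_intCast, map_intCast, map_zero, hi]
    exact hrelk
  have hconj : t ^ ℓ = -(p : 𝓞 (realField R) ⧸ v.asIdeal) - t := by
    have h0 : (t ^ ℓ - t) * (t ^ ℓ - (-(p : 𝓞 (realField R) ⧸ v.asIdeal) - t)) = 0 := by
      linear_combination hfrob_root - hrelk
    rcases mul_eq_zero.1 h0 with h | h
    · exact absurd (sub_eq_zero.1 h) hne
    · exact sub_eq_zero.1 h
  have hnorm : t ^ (ℓ + 1) = (q : 𝓞 (realField R) ⧸ v.asIdeal) := by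
    rw [pow_succ, hconj]; linear_combination (-1 : 𝓞 (realField R) ⧸ v.asIdeal) * hrelk
  -- a square root `u` of `t` would make `q` a square in `𝔽_ℓ`
  rintro ⟨u, hu⟩
  have hu2 : u ^ (ℓ ^ 2) = u := by
    haveI : v.asIdeal.IsMaximal := v.isMaximal
    letI : Field (𝓞 (realField R) ⧸ v.asIdeal) := Ideal.Quotient.field v.asIdeal
    have h := FiniteField.pow_card u
    rw [hcard] at h
    exact h
  have hw : (u ^ (ℓ + 1)) ^ ℓ = u ^ (ℓ + 1) := by
    calc (u ^ (ℓ + 1)) ^ ℓ = u ^ (ℓ ^ 2) * u ^ ℓ := by ring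
      _ = u ^ (ℓ + 1) := by rw [hu2]; ring
  obtain ⟨j, hj⟩ := exists_zmod_cast_eq_of_pow_eq_self (K := 𝓞 (realField R) ⧸ v.asIdeal) hw
  apply hq
  refine ⟨j, ψ.injective ?_⟩
  rw [map_mul, hj, map_intCast, ← hnorm, hu]
  ring

/-- **THEOREM (inert primes are non-norms).** On the quadratic carrier `R = S² + pS + q`: for an odd prime `ℓ` with
`p² - 4q` AND `q` non-squares mod `ℓ`, **`[ℓ] ≠ [(-1)^k]` for every `k`** — the place `v ∋ ℓ` of `F` is `(ℓ)`
(`N v = ℓ²`), `ord_v ℓ = 1` is odd, `θ` is a `v`-unit and a non-square mod `v` (inert in `E`), so `v ∈ T(ℓ)`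
(O'Meara 63:12). For the cyclic quartic carriers (`q`, `p² - 4q ∈ d·ℚ²`): every prime inert in `F = ℚ(√d)` is a
non-norm. [cite: Deligne1982HodgeCycles, §4 (1) and Cor. 4.2] [cite: Omeara1963, §63B Example 63:12] -/
theorem mk_natCast_ne_splitDiscriminantClassCM_of_not_isSquare_disc_const {p q : ℤ}
    (hR : R = X ^ 2 + C p * X + C q) {ℓ : ℕ} (hℓ : ℓ.Prime) (hℓ2 : ℓ ≠ 2)
    (hdisc : ¬ IsSquare ((p ^ 2 - 4 * q : ℤ) : ZMod ℓ)) (hq : ¬ IsSquare ((q : ℤ) : ZMod ℓ))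
    (qℓ : (realField R)ˣ) (hqℓ : (qℓ : realField R) = ℓ) (k : ℕ) :
    (QuotientGroup.mk qℓ : cmNormResidueGroup R) ≠ splitDiscriminantClassCM R k := by
  have hK := finrank_realField_quadratic hR
  obtain ⟨hRm, -⟩ := monic_and_natDegree_of_quadratic R hR
  obtain ⟨θₒ, hθ⟩ := exists_ringOfIntegers_coe_eq_root hRm
  have hrel := ringOfIntegers_root_rel_quadratic hR hθ
  have hℓZ : Prime (ℓ : ℤ) := Nat.prime_iff_prime_int.1 hℓ
  -- a place over `ℓ`
  have hntop : Ideal.span {(ℓ : 𝓞 (realField R))} ≠ ⊤ := fun h ↦ by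
    have := congrArg Ideal.absNorm h
    rw [absNorm_span_natCast, hK, Ideal.absNorm_top] at this
    exact hℓ.one_lt.ne' (by simpa using this)
  obtain ⟨M, hM, hle⟩ := Ideal.exists_le_maximal _ hntop
  have hℓM : (ℓ : 𝓞 (realField R)) ∈ M := hle (Ideal.mem_span_singleton_self _)
  have hMbot : M ≠ ⊥ := fun h ↦ by
    rw [h, Submodule.mem_bot, Nat.cast_eq_zero] at hℓM; exact hℓ.ne_zero hℓM
  let v : HeightOneSpectrum (𝓞 (realField R)) := ⟨M, hM.isPrime, hMbot⟩
  have hℓv : (ℓ : 𝓞 (realField R)) ∈ v.asIdeal := hℓM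
  have hℓv' : ((ℓ : ℤ) : 𝓞 (realField R)) ∈ v.asIdeal := by push_cast; exact hℓv
  -- `v = (ℓ)`, `ord_v ℓ = 1`
  have hN := absNorm_eq_sq_of_not_isSquare_disc hR hθ hℓ hdisc v hℓv
  have hv : v.asIdeal = Ideal.span {(ℓ : 𝓞 (realField R))} :=
    (ideal_eq_of_le_of_absNorm_eq hle (by rw [hN]; exact pow_ne_zero _ hℓ.ne_zero)
      (by rw [absNorm_span_natCast, hK, hN])).symm
  have hord : WithZero.log (v.valuation (realField R) (ℓ : realField R)) = -1 := by
    rw [show (ℓ : realField R) = algebraMap (𝓞 (realField R)) (realField R) (ℓ : 𝓞 (realField R)) by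
      rw [map_natCast], HeightOneSpectrum.valuation_of_algebraMap,
      HeightOneSpectrum.intValuation_singleton (v := v) (by exact_mod_cast hℓ.ne_zero) hv, WithZero.log_exp]
  -- `2 ∉ v`, `θₒ ∉ v`
  have h2 : (2 : 𝓞 (realField R)) ∉ v.asIdeal := by
    have h2' : ¬ (ℓ : ℤ) ∣ 2 := fun h ↦ by
      have := Int.le_of_dvd (by norm_num) h; have := hℓ.two_le; omega
    have := intCast_notMem_of_isCoprime v ((Prime.coprime_iff_not_dvd hℓZ).2 h2') hℓv'
    push_cast at this; exact this
  have hq0 : ¬ (ℓ : ℤ) ∣ q := fun h ↦ hq (by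
    rw [(ZMod.intCast_zmod_eq_zero_iff_dvd q ℓ).2 h]; exact IsSquare.zero)
  have hθv : θₒ ∉ v.asIdeal := fun h ↦ by
    have hqv : (q : 𝓞 (realField R)) ∈ v.asIdeal := by
      have e : (q : 𝓞 (realField R)) = -(θₒ * (θₒ + p)) := by linear_combination hrel
      rw [e]; exact v.asIdeal.neg_mem (v.asIdeal.mul_mem_right _ h)
    exact intCast_notMem_of_isCoprime v ((Prime.coprime_iff_not_dvd hℓZ).2 hq0) hℓv' hqv
  -- `v ∈ T(ℓ)`: `θ` a `v`-unit, non-square mod `v`, `ord_v ℓ` odd (part 3)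
  have hns := not_isSquare_residue_root_of_not_isSquare_disc_const hR hθ hℓ hdisc hq v hℓv
  have hodd : Odd (WithZero.log (v.valuation (realField R) (qℓ : realField R))) := by
    rw [hqℓ, hord]; decide
  exact mk_ne_splitDiscriminantClassCM_of_odd_log_valuation hθ v h2 hθv hns hodd k

/-! ### §54 The five cyclic census carriers: every prime inert in `F` (and prime to `q`) is a non-norm -/

/-- **`ℚ(ζ₅)` (`R = S² + 5S + 5`, `F = ℚ(√5)`): `[ℓ] ≠ [(-1)^k]` for every prime `ℓ ≡ ±2 (mod 5)`** (`ℓ` inert in `F`;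
`p² - 4q = q = 5`) — the inert half of b03.16 for `ℚ(ζ₅)`, by the uniform route. [cite: Deligne1982HodgeCycles, §4 Cor. 4.2] -/
theorem zeta5_ratPrimeRule_mk_prime_ne_splitDiscriminantClassCM_of_inert (hR : R = X ^ 2 + C 5 * X + C 5) {ℓ : ℕ}
    (hℓ : ℓ.Prime) (h2 : ℓ ≠ 2) (hmod : ℓ % 5 = 2 ∨ ℓ % 5 = 3) (qℓ : (realField R)ˣ) (hq : (qℓ : realField R) = ℓ)
    (k : ℕ) : (QuotientGroup.mk qℓ : cmNormResidueGroup R) ≠ splitDiscriminantClassCM R k := by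
  haveI := Fact.mk hℓ
  have h5 : ¬ IsSquare (5 : ZMod ℓ) := not_isSquare_five_of_mod_five h2 hmod
  refine mk_natCast_ne_splitDiscriminantClassCM_of_not_isSquare_disc_const hR hℓ h2 ?_ ?_ qℓ hq k
  · have e : (((5 : ℤ) ^ 2 - 4 * 5 : ℤ) : ZMod ℓ) = 5 := by push_cast; norm_num
    rw [e]; exact h5
  · have e : (((5 : ℤ) : ℤ) : ZMod ℓ) = 5 := by push_cast; norm_num
    rw [e]; exact h5

/-- **`ℚ(√-(5+√5))` (`R = S² + 10S + 20`, `F = ℚ(√5)`, conductor `40`): `[ℓ] ≠ [(-1)^k]` for every prime `ℓ ≡ ±2 (mod 5)`**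
(`p² - 4q = q = 20 = 5·2²`). [cite: Deligne1982HodgeCycles, §4 Cor. 4.2] -/
theorem sqrtNegFivePlusSqrtFive_ratPrimeRule_mk_prime_ne_splitDiscriminantClassCM_of_inert
    (hR : R = X ^ 2 + C 10 * X + C 20) {ℓ : ℕ} (hℓ : ℓ.Prime) (h2 : ℓ ≠ 2) (hmod : ℓ % 5 = 2 ∨ ℓ % 5 = 3)
    (qℓ : (realField R)ˣ) (hq : (qℓ : realField R) = ℓ) (k : ℕ) :
    (QuotientGroup.mk qℓ : cmNormResidueGroup R) ≠ splitDiscriminantClassCM R k := by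
  haveI := Fact.mk hℓ
  have h5 : ¬ IsSquare (5 : ZMod ℓ) := not_isSquare_five_of_mod_five h2 hmod
  have h20 : (2 : ZMod ℓ) ≠ 0 := by exact_mod_cast natCast_prime_ne_zero_zmod Nat.prime_two h2
  refine mk_natCast_ne_splitDiscriminantClassCM_of_not_isSquare_disc_const hR hℓ h2 ?_ ?_ qℓ hq k
  · have e : (((10 : ℤ) ^ 2 - 4 * 20 : ℤ) : ZMod ℓ) = 5 * 2 ^ 2 := by push_cast; norm_num
    rw [e, isSquare_mul_sq_iff_of_ne_zero h20]; exact h5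
  · have e : (((20 : ℤ) : ℤ) : ZMod ℓ) = 5 * 2 ^ 2 := by push_cast; norm_num
    rw [e, isSquare_mul_sq_iff_of_ne_zero h20]; exact h5

/-- **`ℚ(√-3(5+√5)/2)` (`R = S² + 15S + 45`, `F = ℚ(√5)`, conductor `60`): `[ℓ] ≠ [(-1)^k]` for every prime
`ℓ ≡ ±2 (mod 5)`, `ℓ ≠ 3`** (`p² - 4q = q = 45 = 5·3²`). [cite: Deligne1982HodgeCycles, §4 Cor. 4.2] -/
theorem sqrtNegThreeTimesFivePlusSqrtFiveHalf_ratPrimeRule_mk_prime_ne_splitDiscriminantClassCM_of_inert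
    (hR : R = X ^ 2 + C 15 * X + C 45) {ℓ : ℕ} (hℓ : ℓ.Prime) (h2 : ℓ ≠ 2) (h3 : ℓ ≠ 3)
    (hmod : ℓ % 5 = 2 ∨ ℓ % 5 = 3) (qℓ : (realField R)ˣ) (hq : (qℓ : realField R) = ℓ) (k : ℕ) :
    (QuotientGroup.mk qℓ : cmNormResidueGroup R) ≠ splitDiscriminantClassCM R k := by
  haveI := Fact.mk hℓ
  have h5 : ¬ IsSquare (5 : ZMod ℓ) := not_isSquare_five_of_mod_five h2 hmod
  have h30 : (3 : ZMod ℓ) ≠ 0 := by exact_mod_cast natCast_prime_ne_zero_zmod Nat.prime_three h3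
  refine mk_natCast_ne_splitDiscriminantClassCM_of_not_isSquare_disc_const hR hℓ h2 ?_ ?_ qℓ hq k
  · have e : (((15 : ℤ) ^ 2 - 4 * 45 : ℤ) : ZMod ℓ) = 5 * 3 ^ 2 := by push_cast; norm_num
    rw [e, isSquare_mul_sq_iff_of_ne_zero h30]; exact h5
  · have e : (((45 : ℤ) : ℤ) : ZMod ℓ) = 5 * 3 ^ 2 := by push_cast; norm_num
    rw [e, isSquare_mul_sq_iff_of_ne_zero h30]; exact h5

/-- **`ℚ(√-(2+√2))` (`R = S² + 4S + 2`, `F = ℚ(√2)`, inside `ℚ(ζ₁₆)`): `[ℓ] ≠ [(-1)^k]` for every prime `ℓ ≡ ±3 (mod 8)`**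
(`p² - 4q = 8 = 2·2²`, `q = 2`) — the inert half of b03.16 for this field, by the uniform route.
[cite: Deligne1982HodgeCycles, §4 Cor. 4.2] -/
theorem sqrtNegTwoPlusSqrtTwo_ratPrimeRule_mk_prime_ne_splitDiscriminantClassCM_of_inert
    (hR : R = X ^ 2 + C 4 * X + C 2) {ℓ : ℕ} (hℓ : ℓ.Prime) (hmod : ℓ % 8 = 3 ∨ ℓ % 8 = 5)
    (qℓ : (realField R)ˣ) (hq : (qℓ : realField R) = ℓ) (k : ℕ) :
    (QuotientGroup.mk qℓ : cmNormResidueGroup R) ≠ splitDiscriminantClassCM R k := by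
  haveI := Fact.mk hℓ
  have h2 : ℓ ≠ 2 := by omega
  have hn2 : ¬ IsSquare (2 : ZMod ℓ) := by rw [ZMod.exists_sq_eq_two_iff h2]; omega
  have h20 : (2 : ZMod ℓ) ≠ 0 := by exact_mod_cast natCast_prime_ne_zero_zmod Nat.prime_two h2
  refine mk_natCast_ne_splitDiscriminantClassCM_of_not_isSquare_disc_const hR hℓ h2 ?_ ?_ qℓ hq k
  · have e : (((4 : ℤ) ^ 2 - 4 * 2 : ℤ) : ZMod ℓ) = 2 * 2 ^ 2 := by push_cast; norm_num
    rw [e, isSquare_mul_sq_iff_of_ne_zero h20]; exact hn2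
  · have e : (((2 : ℤ) : ℤ) : ZMod ℓ) = 2 := by push_cast; norm_num
    rw [e]; exact hn2

/-- **`ℚ(√-3(2+√2))` (`R = S² + 12S + 18`, `F = ℚ(√2)`, conductor `48`): `[ℓ] ≠ [(-1)^k]` for every prime
`ℓ ≡ ±3 (mod 8)`, `ℓ ≠ 3`** (`p² - 4q = 72 = 2·6²`, `q = 18 = 2·3²`). [cite: Deligne1982HodgeCycles, §4 Cor. 4.2] -/
theorem sqrtNegThreeTimesTwoPlusSqrtTwo_ratPrimeRule_mk_prime_ne_splitDiscriminantClassCM_of_inert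
    (hR : R = X ^ 2 + C 12 * X + C 18) {ℓ : ℕ} (hℓ : ℓ.Prime) (h3 : ℓ ≠ 3) (hmod : ℓ % 8 = 3 ∨ ℓ % 8 = 5)
    (qℓ : (realField R)ˣ) (hq : (qℓ : realField R) = ℓ) (k : ℕ) :
    (QuotientGroup.mk qℓ : cmNormResidueGroup R) ≠ splitDiscriminantClassCM R k := by
  haveI := Fact.mk hℓ
  have h2 : ℓ ≠ 2 := by omega
  have hn2 : ¬ IsSquare (2 : ZMod ℓ) := by rw [ZMod.exists_sq_eq_two_iff h2]; omega
  have h60 : (6 : ZMod ℓ) ≠ 0 := by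
    have h20 : (2 : ZMod ℓ) ≠ 0 := by exact_mod_cast natCast_prime_ne_zero_zmod Nat.prime_two h2
    have h30 : (3 : ZMod ℓ) ≠ 0 := by exact_mod_cast natCast_prime_ne_zero_zmod Nat.prime_three h3
    rw [show (6 : ZMod ℓ) = 2 * 3 by norm_num]; exact mul_ne_zero h20 h30
  have h30 : (3 : ZMod ℓ) ≠ 0 := by exact_mod_cast natCast_prime_ne_zero_zmod Nat.prime_three h3
  refine mk_natCast_ne_splitDiscriminantClassCM_of_not_isSquare_disc_const hR hℓ h2 ?_ ?_ qℓ hq k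
  · have e : (((12 : ℤ) ^ 2 - 4 * 18 : ℤ) : ZMod ℓ) = 2 * 6 ^ 2 := by push_cast; norm_num
    rw [e, isSquare_mul_sq_iff_of_ne_zero h60]; exact hn2
  · have e : (((18 : ℤ) : ℤ) : ZMod ℓ) = 2 * 3 ^ 2 := by push_cast; norm_num
    rw [e, isSquare_mul_sq_iff_of_ne_zero h30]; exact hn2

end Inert

end Summit.HodgeConjecture.HodgeConjecture.Ring2.WeilCoverageCM

end
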